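import Summits.ABC.ABC.Theorems.CongruentialReceptacleTameLocalReceptacleCellLawsDefs
import Summits.ABC.ABC.Theorems.CongruentialReceptacleTameLocalReceptacleStubMatchingFamiliesOfKeyCells

/-!
# Crux `TameLocalReceptacle` (stmt-ABC-14354), line `grh-friable-cell-resolution`:
# engine output ⇒ key-cell structure

Registered stub `stub_keyCells_of_cellLaws : CellLawsPackage (1/4) → TiltBound → KeyCellStructure (1/4)` of the
checked skeleton `Cruxes/TameLocalReceptacle/Lines/grh_friable_cell_resolution.lean` (lead
`prover-line-stmt-ABC-14354-a1-0`).  Pure finite-sum bookkeeping over `…KeyCellDefs.lean` / `…CellLawsDefs.lean`; the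
per-cell and per-family facts (sub-namespace `CellLawsBook`) are stated for GENERAL parameters, for reuse by variants
of the engine output.
* (B2) `weighted_cellMass_le`: `Σ_{q,v} keyWeight·cellMass ≤ 6LN` under `SizeClause L N` — enlarge the truncation,
  read the total as the family mean of the window-weighted odd parts (`KeyCellBook.mean_oddPart_eq`), and bound per
  triple by `Σ_{q ∣ m_P} (v_q a + v_q b + v_q c + 1) log q ≤ 2 (log a + log b + log c)`.
* (B3) `cellMass_eq_zero_of_lt`: no keys above the friability bound.
* (B4) the CELL ERROR `E(m) = Σ_{classes} |I − 𝟙[adm]·m|` against a model value `m`: `|cellMass − (q−1)²m| ≤ E(m)`,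
  the class sum of (CE) is `≤ 2·keyWeight·E(m)` for ANY `m` (`ce_cell_le`); with `m :=` the local model on SHALLOW
  cells (`q ≤ yb`, `q^{v+1} ≤ Y`; there `E ≤ e(q−1)²m ≤ 2e·cellMass`) and `0` elsewhere (`E(0) = cellMass`, a
  `TailSmall` term or zero), `Σ_{q,v} keyWeight·E ≤ 12eLN + e` (`err_sum_le`); hence `classDiscrepancy ≤ 24eLN + 2e`
  and, by `|cm_F − cm_G| ≤ E_F + (q−1)²|m_F − m_G| + E_G` and `TiltBound`, `valuationDiscrepancy ≤ 24eLN + 2e + C_T`.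
* The stub: `e := min (1/2) (δ/(48(L+1)))`, depth `max N₁ (⌈2C_T/δ⌉₊ + 1)`, families and shape clauses verbatim.
-/

-- `Summit.<Summit>.<Problem>` is the mandated summit-side namespace (CONVENTIONS §2); for the
-- single-conjunct summit `ABC` the two coincide, so the duplicate `ABC.ABC` is deliberate.
set_option linter.dupNamespace false

noncomputable section

namespace Summit.ABC.ABC.Theorems.TameLocalReceptacle

open Finset Literature.NumberTheory.DiophantineGeometry KeyCellBook

namespace CellLawsBook

/-! ### Signs, means, the model mass -/

/-- Window weights are nonnegative. [folklore] -/
theorem keyWeight_nonneg (e : ℕ × ℕ × ℕ) (q : ℕ) : 0 ≤ keyWeight e q :=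
  mul_nonneg (by positivity) (Real.log_natCast_nonneg q)

/-- Key intensities are nonnegative. [folklore] -/
theorem intensity_nonneg (F : Finset (ℕ × ℕ × ℕ)) (P : Pos) (q : ℕ) (D : ℕ × ℕ × ℕ × ℕ × ℕ × ℕ) :
    0 ≤ intensity F P q D := by
  unfold intensity mean
  exact div_nonneg (Finset.sum_nonneg fun T _ => by split_ifs <;> norm_num) (Nat.cast_nonneg _)

/-- Cell masses are nonnegative. [folklore] -/
theorem cellMass_nonneg (F : Finset (ℕ × ℕ × ℕ)) (P : Pos) (q v : ℕ) : 0 ≤ cellMass F P q v :=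
  Finset.sum_nonneg fun _ _ => Finset.sum_nonneg fun _ _ => Finset.sum_nonneg fun _ _ =>
    intensity_nonneg F P q _

/-- A pointwise bound on a nonempty family passes to the mean. [folklore] -/
theorem mean_le_of_le {F : Finset (ℕ × ℕ × ℕ)} (hF : F.Nonempty) {f : ℕ × ℕ × ℕ → ℝ} {C : ℝ}
    (h : ∀ T ∈ F, f T ≤ C) : mean F f ≤ C := by
  rw [mean, div_le_iff₀ (by exact_mod_cast hF.card_pos), mul_comm]
  simpa using Finset.sum_le_card_nsmul F f C h

/-- The model mass of a cell: `Σ_{(r,s,z)} 𝟙[adm] · x = (q−1)² · x` (`stub_admMass`). [folklore] -/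
theorem sum_box_ite (P : Pos) {q : ℕ} (hq : 1 ≤ q) (x : ℝ) :
    ∑ r ∈ range q, ∑ s ∈ range q, ∑ z ∈ range q, (if P.adm q r s z then x else 0) =
      ((q : ℝ) - 1) ^ 2 * x := by
  rw [← stub_admMass P q hq]
  simp only [Finset.sum_mul, ite_mul, one_mul, zero_mul]

/-! ### (B3) No keys above the friability bound -/

/-- Above the friability bound every cell mass of a family of abc-triples vanishes (the member in position `P`
divides `abc`, whose prime factors `FriableMembers` bounds). [folklore] -/
theorem cellMass_eq_zero_of_lt {F : Finset (ℕ × ℕ × ℕ)} {yb q : ℕ} (habc : ∀ T ∈ F, IsABCTriple T.1 T.2.1 T.2.2)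
    (hfr : FriableMembers yb F) (hq : yb < q) (P : Pos) (v : ℕ) : cellMass F P q v = 0 := by
  refine Finset.sum_eq_zero fun r _ => Finset.sum_eq_zero fun s _ => Finset.sum_eq_zero fun z _ => ?_
  rw [intensity, mean_congr (g := fun _ => 0) fun T hT => ?_]
  · simp [mean]
  refine if_neg ?_
  rintro ⟨hmem, -⟩
  obtain ⟨ha, hb, hc, -⟩ := habc T hT
  have h0 : T.1 * T.2.1 * T.2.2 ≠ 0 := Nat.mul_ne_zero (Nat.mul_ne_zero ha.ne' hb.ne') (by omega)
  have hdvd : P.sel T ∣ T.1 * T.2.1 * T.2.2 := by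
    cases P
    exacts [dvd_mul_of_dvd_left (dvd_mul_right _ _) _, dvd_mul_of_dvd_left (dvd_mul_left _ _) _,
      dvd_mul_left _ _]
  exact absurd (hfr T hT q (Nat.primeFactors_mono hdvd h0 hmem)) (not_le.2 hq)

/-! ### (B2) The window-weighted mass of all keys of a family -/

/-- `Σ_{q ∈ S} v_q(n) · log q ≤ log n` for every finite `S`. [folklore] -/
theorem sum_factorization_mul_log_le (n : ℕ) (S : Finset ℕ) :
    ∑ q ∈ S, (n.factorization q : ℝ) * Real.log q ≤ Real.log n := by
  calc ∑ q ∈ S, (n.factorization q : ℝ) * Real.log q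
      ≤ ∑ q ∈ S ∪ n.primeFactors, (n.factorization q : ℝ) * Real.log q :=
        Finset.sum_le_sum_of_subset_of_nonneg Finset.subset_union_left fun q _ _ =>
          mul_nonneg (Nat.cast_nonneg _) (Real.log_natCast_nonneg q)
    _ = ∑ q ∈ n.primeFactors, (n.factorization q : ℝ) * Real.log q := by
        refine (Finset.sum_subset Finset.subset_union_right fun q _ hq => ?_).symm
        have hz : n.factorization q = 0 := Finsupp.notMem_support_iff.1 (by rwa [Nat.support_factorization])
        simp [hz]
    _ = Real.log n := by
        rw [Real.log_nat_eq_sum_factorization n, Finsupp.sum, Nat.support_factorization]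

/-- On an abc-triple with `c ≤ e^{LN}`, the window weights `(v_q a + v_q b + v_q c + 1) log q` of its data at the odd
prime factors `q` of a member sum to at most `6LN` (`v + 1 ≤ 2v` for `v ≥ 1`, and `Σ_q v_q(n) log q ≤ log n ≤ LN`
for `n = a, b, c`). [folklore] -/
theorem sum_datumWeight_le (P : Pos) {T : ℕ × ℕ × ℕ} (hT : IsABCTriple T.1 T.2.1 T.2.2) {L : ℝ} {N : ℕ}
    (hc : (T.2.2 : ℝ) ≤ Real.exp (L * N)) :
    ∑ q ∈ (P.sel T).primeFactors.erase 2, evalAt (fun p i j k _ _ _ => (((i + j + k : ℕ) : ℝ) + 1) * Real.log p)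
      q (datum T.1 T.2.1 T.2.2 q) ≤ 6 * (L * N) := by
  obtain ⟨ha, hb, habc, -⟩ := hT
  have hlog : ∀ {m : ℕ}, 0 < m → m ≤ T.2.2 → Real.log m ≤ L * N := fun hm hle =>
    (Real.log_le_log (by exact_mod_cast hm) ((Nat.cast_le.2 hle).trans hc)).trans_eq (Real.log_exp _)
  have hterm : ∀ q ∈ (P.sel T).primeFactors.erase 2,
      evalAt (fun p i j k _ _ _ => (((i + j + k : ℕ) : ℝ) + 1) * Real.log p) q (datum T.1 T.2.1 T.2.2 q) ≤
        2 * ((T.1.factorization q : ℝ) * Real.log q) + 2 * ((T.2.1.factorization q : ℝ) * Real.log q) +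
          2 * ((T.2.2.factorization q : ℝ) * Real.log q) := by
    intro q hq
    obtain ⟨hp, hdvd, hm0⟩ := Nat.mem_primeFactors.1 (Finset.mem_of_mem_erase hq)
    have h1 := hp.factorization_pos_of_dvd hm0 hdvd
    have h1' : 1 ≤ T.1.factorization q + T.2.1.factorization q + T.2.2.factorization q := by
      cases P <;> simp only [Pos.sel] at h1 <;> omega
    have h1r : (1 : ℝ) ≤ T.1.factorization q + T.2.1.factorization q + T.2.2.factorization q := by
      exact_mod_cast h1'
    simp only [evalAt, datum, Nat.cast_add]
    nlinarith [Real.log_natCast_nonneg q]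
  refine (Finset.sum_le_sum hterm).trans ?_
  simp only [Finset.sum_add_distrib, ← Finset.mul_sum]
  linarith [hlog ha (by omega), hlog hb (by omega), hlog (by omega : 0 < T.2.2) le_rfl,
    sum_factorization_mul_log_le T.1 ((P.sel T).primeFactors.erase 2),
    sum_factorization_mul_log_le T.2.1 ((P.sel T).primeFactors.erase 2),
    sum_factorization_mul_log_le T.2.2 ((P.sel T).primeFactors.erase 2)]

/-- **(B2)** `Σ_{q,v} keyWeight · cellMass F P q v ≤ 6LN` for a nonempty family of abc-triples with `c ≤ e^{LN}`:
enlarge the truncation beyond `Q`, `V` and all members (the terms are `≥ 0`), read the total as the family mean of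
the window-weighted odd parts (`KeyCellBook.mean_oddPart_eq` for the weight `(i+j+k+1)·log p`), and bound per triple
(`sum_datumWeight_le`). [folklore] -/
theorem weighted_cellMass_le (P : Pos) {F : Finset (ℕ × ℕ × ℕ)} {L : ℝ} {N : ℕ} (hF0 : F.Nonempty)
    (habc : ∀ T ∈ F, IsABCTriple T.1 T.2.1 T.2.2) (hS : SizeClause L N F) (Q V : ℕ) :
    ∑ q ∈ oddPrimesBelow Q, ∑ v ∈ Icc 1 V, keyWeight (P.exps v) q * cellMass F P q v ≤ 6 * (L * N) := by
  -- a common truncation `M` beyond `Q`, `V` and all members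
  obtain ⟨M, hQM, hVM, hM⟩ : ∃ M, Q ≤ M ∧ V ≤ M ∧ ∀ T ∈ F, P.sel T < M :=
    ⟨max (max Q V) (F.sup P.sel + 1), (le_max_left _ _).trans (le_max_left _ _),
      (le_max_right _ _).trans (le_max_left _ _),
      fun T hT => (Nat.lt_succ_of_le (Finset.le_sup (f := P.sel) hT)).trans_le (le_max_right _ _)⟩
  have h0 : ∀ q v, 0 ≤ keyWeight (P.exps v) q * cellMass F P q v := fun q v =>
    mul_nonneg (keyWeight_nonneg _ _) (cellMass_nonneg F P q v)
  calc _ ≤ ∑ q ∈ oddPrimesBelow M, ∑ v ∈ Icc 1 M, keyWeight (P.exps v) q * cellMass F P q v :=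
        (Finset.sum_le_sum fun q _ => Finset.sum_le_sum_of_subset_of_nonneg (Finset.Icc_subset_Icc_right hVM)
          fun v _ _ => h0 q v).trans (Finset.sum_le_sum_of_subset_of_nonneg
          (Finset.filter_subset_filter _ (Finset.range_subset_range.2 hQM)) fun q _ _ =>
            Finset.sum_nonneg fun v _ => h0 q v)
    _ = mean F (fun T => ∑ q ∈ (P.sel T).primeFactors.erase 2,
          evalAt (fun p i j k _ _ _ => (((i + j + k : ℕ) : ℝ) + 1) * Real.log p) q (datum T.1 T.2.1 T.2.2 q)) := by
        rw [mean_oddPart_eq P _ habc hM]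
        simp only [cellMass, Finset.mul_sum]
        rfl
    _ ≤ 6 * (L * N) := mean_le_of_le hF0 fun T hT => sum_datumWeight_le P (habc T hT) (hS T hT)

/-! ### (B4) One valuation cell -/

/-- `|cellMass − (q−1)²·m| ≤ E(m)` for every model value `m`. [folklore] -/
theorem abs_cellMass_sub_le (F : Finset (ℕ × ℕ × ℕ)) (P : Pos) {q : ℕ} (hq : 1 ≤ q) (v : ℕ) (m : ℝ) :
    |cellMass F P q v - ((q : ℝ) - 1) ^ 2 * m| ≤ (∑ r ∈ range q, ∑ s ∈ range q, ∑ z ∈ range q, |intensity F P q (mkDatum (Pos.exps P v) r s z) - ite (Pos.adm P q r s z = true) (m) (0 : ℝ)|) := by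
  rw [← sum_box_ite P hq m, cellMass]
  simp only [← Finset.sum_sub_distrib]
  exact abs_sum_le_of_le fun r _ => abs_sum_le_of_le fun s _ => abs_sum_le_of_le fun z _ => le_rfl

/-- For EVERY model value `m`, the class sum of (CE) inside a cell is at most `2·keyWeight·E(m)`:
`|I − U| ≤ |I − 𝟙m| + 𝟙·|m − cellMass/(q−1)²|` and `Σ 𝟙·|m − cellMass/(q−1)²| = |(q−1)²m − cellMass| ≤ E(m)`.
[folklore] -/
theorem ce_cell_le (F : Finset (ℕ × ℕ × ℕ)) (P : Pos) {q : ℕ} (hq : q.Prime) (v : ℕ) (m : ℝ) :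
    ∑ r ∈ range q, ∑ s ∈ range q, ∑ z ∈ range q, keyWeight (P.exps v) q *
        |intensity F P q (mkDatum (P.exps v) r s z) -
          (if P.adm q r s z then cellMass F P q v / ((q : ℝ) - 1) ^ 2 else 0)| ≤
      2 * (keyWeight (P.exps v) q * (∑ r ∈ range q, ∑ s ∈ range q, ∑ z ∈ range q, |intensity F P q (mkDatum (Pos.exps P v) r s z) - ite (Pos.adm P q r s z = true) (m) (0 : ℝ)|)) := by
  have h2 : (2 : ℝ) ≤ q := by exact_mod_cast hq.two_le
  have hA0 : (0 : ℝ) < ((q : ℝ) - 1) ^ 2 := pow_pos (by linarith) 2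
  have hd : ((q : ℝ) - 1) ^ 2 * |m - cellMass F P q v / ((q : ℝ) - 1) ^ 2| ≤ (∑ r ∈ range q, ∑ s ∈ range q, ∑ z ∈ range q, |intensity F P q (mkDatum (Pos.exps P v) r s z) - ite (Pos.adm P q r s z = true) (m) (0 : ℝ)|) := by
    rw [← abs_of_pos hA0, ← abs_mul, mul_sub, abs_of_pos hA0, mul_div_cancel₀ _ hA0.ne', abs_sub_comm]
    exact abs_cellMass_sub_le F P hq.one_le v m
  have hpt : ∀ r s z, |intensity F P q (mkDatum (P.exps v) r s z) -
      (if P.adm q r s z then cellMass F P q v / ((q : ℝ) - 1) ^ 2 else 0)| ≤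
      |intensity F P q (mkDatum (P.exps v) r s z) - (if P.adm q r s z then m else 0)| +
        (if P.adm q r s z then |m - cellMass F P q v / ((q : ℝ) - 1) ^ 2| else 0) := by
    intro r s z
    refine (abs_sub_le _ (if P.adm q r s z then m else 0) _).trans (add_le_add le_rfl (le_of_eq ?_))
    split_ifs <;> simp
  calc _ ≤ ∑ r ∈ range q, ∑ s ∈ range q, ∑ z ∈ range q, keyWeight (P.exps v) q *
          (|intensity F P q (mkDatum (P.exps v) r s z) - (if P.adm q r s z then m else 0)| +
            (if P.adm q r s z then |m - cellMass F P q v / ((q : ℝ) - 1) ^ 2| else 0)) :=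
        Finset.sum_le_sum fun r _ => Finset.sum_le_sum fun s _ => Finset.sum_le_sum fun z _ =>
          mul_le_mul_of_nonneg_left (hpt r s z) (keyWeight_nonneg _ _)
    _ = keyWeight (P.exps v) q * (∑ r ∈ range q, ∑ s ∈ range q, ∑ z ∈ range q, |intensity F P q (mkDatum (Pos.exps P v) r s z) - ite (Pos.adm P q r s z = true) (m) (0 : ℝ)|) +
          keyWeight (P.exps v) q * (((q : ℝ) - 1) ^ 2 * |m - cellMass F P q v / ((q : ℝ) - 1) ^ 2|) := by
        rw [← sum_box_ite P hq.one_le]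
        simp only [mul_add, Finset.sum_add_distrib, Finset.mul_sum]
    _ ≤ _ := by linarith [mul_le_mul_of_nonneg_left hd (keyWeight_nonneg (P.exps v) q)]

/-- On a cell whose inadmissible classes vanish and whose admissible classes follow the model value `m` up to the
factor `1 ± e`: `E(m) ≤ e·(q−1)²·m`. [folklore] -/
theorem err_le_of_laws (F : Finset (ℕ × ℕ × ℕ)) (P : Pos) {q : ℕ} (hq : 1 ≤ q) (v : ℕ) {e m : ℝ}
    (hIV : ∀ r s z, P.adm q r s z = false → intensity F P q (mkDatum (P.exps v) r s z) = 0)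
    (hSL : ∀ r s z, P.adm q r s z = true → |intensity F P q (mkDatum (P.exps v) r s z) - m| ≤ e * m) :
    (∑ r ∈ range q, ∑ s ∈ range q, ∑ z ∈ range q, |intensity F P q (mkDatum (Pos.exps P v) r s z) - ite (Pos.adm P q r s z = true) (m) (0 : ℝ)|) ≤ e * (((q : ℝ) - 1) ^ 2 * m) := by
  rw [← sum_box_ite P hq m]
  simp only [Finset.mul_sum]
  refine Finset.sum_le_sum fun r _ => Finset.sum_le_sum fun s _ => Finset.sum_le_sum fun z _ => ?_
  by_cases h : P.adm q r s z = true
  · rw [if_pos h]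
    exact hSL r s z h
  · rw [if_neg h, hIV r s z (by simpa using h)]
    simp

/-- THE CELL ESTIMATE.  With the model value `m` on shallow cells (`q ≤ yb`, `q^{v+1} ≤ Y`) and `0` elsewhere,
`keyWeight·E ≤ 2e·keyWeight·cellMass + (the cell's TailSmall term)`: on a shallow cell `E ≤ e(q−1)²m` and
`(q−1)²m ≤ 2·cellMass` (as `|cellMass − (q−1)²m| ≤ E` and `e ≤ 1/2`); elsewhere `E(0) = cellMass`, which vanishes
above `yb`. [folklore] -/
theorem cell_err_le (F : Finset (ℕ × ℕ × ℕ)) (P : Pos) {q : ℕ} (hq : q.Prime) (v : ℕ) {e m : ℝ} {yb Y : ℕ}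
    (he0 : 0 ≤ e) (he : e ≤ 1 / 2)
    (hIV : ∀ r s z, P.adm q r s z = false → intensity F P q (mkDatum (P.exps v) r s z) = 0)
    (hSL : q ≤ yb → q ^ (v + 1) ≤ Y → ∀ r s z, P.adm q r s z = true →
      |intensity F P q (mkDatum (P.exps v) r s z) - m| ≤ e * m)
    (hfar : yb < q → cellMass F P q v = 0) :
    keyWeight (P.exps v) q * (∑ r ∈ range q, ∑ s ∈ range q, ∑ z ∈ range q, |intensity F P q (mkDatum (Pos.exps P v) r s z) - ite (Pos.adm P q r s z = true) ((if q ≤ yb ∧ q ^ (v + 1) ≤ Y then m else 0)) (0 : ℝ)|) ≤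
      2 * e * (keyWeight (P.exps v) q * cellMass F P q v) +
        (if q ^ (v + 1) ≤ Y then 0 else keyWeight (P.exps v) q * cellMass F P q v) := by
  have hkW := keyWeight_nonneg (P.exps v) q
  have hcm := cellMass_nonneg F P q v
  by_cases hsh : q ≤ yb ∧ q ^ (v + 1) ≤ Y
  · rw [if_pos hsh, if_pos hsh.2, add_zero]
    have hE := err_le_of_laws F P hq.one_le v hIV (hSL hsh.1 hsh.2)
    -- `(q−1)²m ≤ 2·cellMass`
    have hAm : ((q : ℝ) - 1) ^ 2 * m ≤ 2 * cellMass F P q v := by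
      rcases le_or_gt 0 (((q : ℝ) - 1) ^ 2 * m) with hM | hM
      · nlinarith [(abs_le.1 ((abs_cellMass_sub_le F P hq.one_le v m).trans hE)).1,
          mul_nonneg (by linarith : (0 : ℝ) ≤ 1 - 2 * e) hM]
      · linarith
    linarith [mul_le_mul_of_nonneg_left (hE.trans (mul_le_mul_of_nonneg_left hAm he0)) hkW]
  · rw [if_neg hsh, show (∑ r ∈ range q, ∑ s ∈ range q, ∑ z ∈ range q, |intensity F P q (mkDatum (Pos.exps P v) r s z) - ite (Pos.adm P q r s z = true) ((0 : ℝ)) (0 : ℝ)|) = cellMass F P q v by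
      simp [abs_of_nonneg, intensity_nonneg, cellMass]]
    split_ifs with hY
    · simp [hfar (not_le.1 fun hyb => hsh ⟨hyb, hY⟩)]
    · nlinarith [mul_nonneg hkW hcm]

/-! ### Summing over the cells -/

/-- The total weighted cell error of a family obeying the cell laws (nonempty, abc-triples, sizes `≤ e^{LN}`, friable
members, vanishing inadmissible classes, shallow law with exponents `(a_A, a_B, a_C)`, small tail), for the model
values of `cell_err_le`: `Σ_{q,v} keyWeight·E ≤ 2e·6LN + e`. [folklore] -/
theorem err_sum_le {F : Finset (ℕ × ℕ × ℕ)} {e L aA aB aC : ℝ} {N yb Y : ℕ} (he0 : 0 ≤ e) (he : e ≤ 1 / 2)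
    (hF : F.Nonempty ∧ (∀ T ∈ F, IsABCTriple T.1 T.2.1 T.2.2) ∧ SizeClause L N F ∧ FriableMembers yb F ∧
      InadmissibleVanish F ∧ ShallowLaw e yb Y aA aB aC F ∧ TailSmall e Y F) (P : Pos) (Q V : ℕ) :
    ∑ q ∈ oddPrimesBelow Q, ∑ v ∈ Icc 1 V, keyWeight (P.exps v) q *
        (∑ r ∈ range q, ∑ s ∈ range q, ∑ z ∈ range q, |intensity F P q (mkDatum (Pos.exps P v) r s z) - ite (Pos.adm P q r s z = true) ((if q ≤ yb ∧ q ^ (v + 1) ≤ Y then cellModel aA aB aC P q v else 0)) (0 : ℝ)|) ≤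
      12 * e * (L * N) + e := by
  obtain ⟨hF0, habc, hS, hfr, hIV, hSL, hTl⟩ := hF
  calc _ ≤ ∑ q ∈ oddPrimesBelow Q, ∑ v ∈ Icc 1 V, (2 * e * (keyWeight (P.exps v) q * cellMass F P q v) +
          (if q ^ (v + 1) ≤ Y then 0 else keyWeight (P.exps v) q * cellMass F P q v)) :=
        Finset.sum_le_sum fun q hq => Finset.sum_le_sum fun v hv => by
          have hqp := prime_of_mem_oddPrimesBelow hq
          have hq2 : q ≠ 2 := (Finset.mem_filter.1 hq).2.2
          have hv1 : 1 ≤ v := (Finset.mem_Icc.1 hv).1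
          exact cell_err_le F P hqp v he0 he (fun r s z h => hIV P q v r s z hqp hq2 hv1 h)
            (fun hyb hY r s z h => hSL P q v r s z hqp hq2 hyb hv1 hY h)
            (fun hyb => cellMass_eq_zero_of_lt habc hfr hyb P v)
    _ ≤ 12 * e * (L * N) + e := by
        simp only [Finset.sum_add_distrib, ← Finset.mul_sum]
        linarith [hTl P Q V, mul_le_mul_of_nonneg_left (weighted_cellMass_le P hF0 habc hS Q V)
          (by positivity : (0 : ℝ) ≤ 2 * e)]

/-- **(CE)** `classDiscrepancy ≤ 24eLN + 2e` (`ce_cell_le` with the model values of `err_sum_le`). [folklore] -/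
theorem ce_bound {F : Finset (ℕ × ℕ × ℕ)} {e L aA aB aC : ℝ} {N yb Y : ℕ} (he0 : 0 ≤ e) (he : e ≤ 1 / 2)
    (hF : F.Nonempty ∧ (∀ T ∈ F, IsABCTriple T.1 T.2.1 T.2.2) ∧ SizeClause L N F ∧ FriableMembers yb F ∧
      InadmissibleVanish F ∧ ShallowLaw e yb Y aA aB aC F ∧ TailSmall e Y F) (P : Pos) (Q V : ℕ) :
    classDiscrepancy F P Q V ≤ 24 * e * (L * N) + 2 * e := by
  unfold classDiscrepancy
  calc _ ≤ ∑ q ∈ oddPrimesBelow Q, ∑ v ∈ Icc 1 V, 2 * (keyWeight (P.exps v) q *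
          (∑ r ∈ range q, ∑ s ∈ range q, ∑ z ∈ range q, |intensity F P q (mkDatum (Pos.exps P v) r s z) - ite (Pos.adm P q r s z = true) ((if q ≤ yb ∧ q ^ (v + 1) ≤ Y then cellModel aA aB aC P q v else 0)) (0 : ℝ)|)) :=
        Finset.sum_le_sum fun q hq => Finset.sum_le_sum fun v _ =>
          ce_cell_le F P (prime_of_mem_oddPrimesBelow hq) v _
    _ ≤ 24 * e * (L * N) + 2 * e := by
        simp only [← Finset.mul_sum]
        linarith [err_sum_le he0 he hF P Q V]

/-- **(VM)** for a compared pair: `valuationDiscrepancy ≤ 24eLN + 2e + C`, where `C` bounds the tilt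
`Σ keyWeight·(q−1)²·|m_F − m_G|` of the two local models (supplied by `TiltBound`): per cell
`|cm_F − cm_G| ≤ E_F + (q−1)²|m⋆_F − m⋆_G| + E_G` for the model values `m⋆` of `cell_err_le`. [folklore] -/
theorem vm_bound {F G : Finset (ℕ × ℕ × ℕ)} {e L aA aB aC aA' aB' aC' C : ℝ} {N yb Y : ℕ} (he0 : 0 ≤ e)
    (he : e ≤ 1 / 2)
    (hF : F.Nonempty ∧ (∀ T ∈ F, IsABCTriple T.1 T.2.1 T.2.2) ∧ SizeClause L N F ∧ FriableMembers yb F ∧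
      InadmissibleVanish F ∧ ShallowLaw e yb Y aA aB aC F ∧ TailSmall e Y F)
    (hG : G.Nonempty ∧ (∀ T ∈ G, IsABCTriple T.1 T.2.1 T.2.2) ∧ SizeClause L N G ∧ FriableMembers yb G ∧
      InadmissibleVanish G ∧ ShallowLaw e yb Y aA' aB' aC' G ∧ TailSmall e Y G) (P : Pos) (Q V : ℕ)
    (hC : ∑ q ∈ oddPrimesBelow Q, ∑ v ∈ Icc 1 V, keyWeight (P.exps v) q *
      ((((q : ℝ) - 1) ^ 2) * |cellModel aA aB aC P q v - cellModel aA' aB' aC' P q v|) ≤ C) :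
    valuationDiscrepancy F G P Q V ≤ 24 * e * (L * N) + 2 * e + C := by
  have h1 := err_sum_le he0 he hF P Q V
  have h2 := err_sum_le he0 he hG P Q V
  unfold valuationDiscrepancy
  calc _ ≤ ∑ q ∈ oddPrimesBelow Q, ∑ v ∈ Icc 1 V, (keyWeight (P.exps v) q *
          (∑ r ∈ range q, ∑ s ∈ range q, ∑ z ∈ range q, |intensity F P q (mkDatum (Pos.exps P v) r s z) - ite (Pos.adm P q r s z = true) ((if q ≤ yb ∧ q ^ (v + 1) ≤ Y then cellModel aA aB aC P q v else 0)) (0 : ℝ)|) +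
          keyWeight (P.exps v) q * (((q : ℝ) - 1) ^ 2 * |cellModel aA aB aC P q v - cellModel aA' aB' aC' P q v|) +
          keyWeight (P.exps v) q *
          (∑ r ∈ range q, ∑ s ∈ range q, ∑ z ∈ range q, |intensity G P q (mkDatum (Pos.exps P v) r s z) - ite (Pos.adm P q r s z = true) ((if q ≤ yb ∧ q ^ (v + 1) ≤ Y then cellModel aA' aB' aC' P q v else 0)) (0 : ℝ)|)) :=
        Finset.sum_le_sum fun q hq => Finset.sum_le_sum fun v _ => by
          have hq1 := (prime_of_mem_oddPrimesBelow hq).one_le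
          set mF : ℝ := (if q ≤ yb ∧ q ^ (v + 1) ≤ Y then cellModel aA aB aC P q v else 0) with hmF
          set mG : ℝ := (if q ≤ yb ∧ q ^ (v + 1) ≤ Y then cellModel aA' aB' aC' P q v else 0) with hmG
          have ht : |mF - mG| ≤ |cellModel aA aB aC P q v - cellModel aA' aB' aC' P q v| := by
            rw [hmF, hmG]
            split_ifs <;> simp
          have hFm := abs_cellMass_sub_le F P hq1 v mF
          have hGm := abs_cellMass_sub_le G P hq1 v mG
          have h3 := abs_sub_le (cellMass F P q v) (((q : ℝ) - 1) ^ 2 * mF) (cellMass G P q v)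
          have h4 := abs_sub_le (((q : ℝ) - 1) ^ 2 * mF) (((q : ℝ) - 1) ^ 2 * mG) (cellMass G P q v)
          rw [← mul_sub, abs_mul, abs_of_nonneg (sq_nonneg ((q : ℝ) - 1))] at h4
          rw [abs_sub_comm] at hGm
          rw [← mul_add, ← mul_add]
          exact mul_le_mul_of_nonneg_left
            (by linarith [mul_le_mul_of_nonneg_left ht (sq_nonneg ((q : ℝ) - 1))]) (keyWeight_nonneg _ _)
    _ ≤ 24 * e * (L * N) + 2 * e + C := by
        simp only [Finset.sum_add_distrib]
        linarith

end CellLawsBook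

open CellLawsBook

/-- **Registered stub `stub_keyCells_of_cellLaws`** (line `grh-friable-cell-resolution` of crux stmt-ABC-14354):
ENGINE OUTPUT ⟹ KEY-CELL STRUCTURE.  Given `⟨V₀, L, _, h⟩ := CellLawsPackage (1/4)` and the tilt constant `C_T`,
for `δ > 0` and `N₁` invoke `h` with the relative error `e := min (1/2) (δ / (48 (L+1)))` at depth
`max N₁ (⌈2 C_T/δ⌉₊ + 1)`; the five families and the shape clauses are reused verbatim, the fifteen (CE) clauses are
`CellLawsBook.ce_bound` and the nine (VM) clauses `CellLawsBook.vm_bound` (the models of a compared pair agree at the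
compared position by the package's exponent assignment, so that `TiltBound` bounds the tilt term), and
`24eLN + 2e + C_T ≤ δN` by the choice of `e` and `N`. [folklore] -/
theorem stub_keyCells_of_cellLaws : CellLawsPackage (1 / 4) → TiltBound → KeyCellStructure (1 / 4) := by
  rintro ⟨V₀, L, hL, hP⟩ ⟨C_T, hT⟩
  refine ⟨V₀, fun δ hδ N₁ => ?_⟩
  -- the relative error and the depth threshold
  set e : ℝ := min (1 / 2) (δ / (48 * (L + 1))) with he_def
  have he_pos : 0 < e := lt_min (by norm_num) (by positivity)
  have he0 : 0 ≤ e := he_pos.le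
  have he2 : e ≤ 1 / 2 := min_le_left _ _
  obtain ⟨N, hN, FA, FB, FC, G, G', α, α', yb, Y, hα, hα', hshape, ⟨sA, sB, sC, sG, sG'⟩,
      ⟨fA, fB, fC, fG, fG'⟩, ⟨iA, iB, iC, iG, iG'⟩, ⟨lA, lB, lC, lG, lG'⟩, ⟨tA, tB, tC, tG, tG'⟩, -⟩ :=
    hP e he_pos (max N₁ (⌈2 * C_T / δ⌉₊ + 1))
  obtain ⟨hFA0, hFB0, hFC0, hG0, hG'0, hFA, hFB, hFC, hG, hG'⟩ := hshape
  have hN' : ⌈2 * C_T / δ⌉₊ + 1 ≤ N := (le_max_right _ _).trans hN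
  have hN1 : (1 : ℝ) ≤ N := by exact_mod_cast (by omega : 1 ≤ N)
  have hCT : 2 * C_T ≤ δ * N := by
    have h2 : 2 * C_T / δ ≤ N := (Nat.le_ceil _).trans (by exact_mod_cast (by omega : ⌈2 * C_T / δ⌉₊ ≤ N))
    rwa [div_le_iff₀' hδ] at h2
  -- the budget: `24eLN + 2e + C ≤ δN` whenever `2C ≤ δN`
  have hbud : ∀ C : ℝ, 2 * C ≤ δ * N → 24 * e * (L * N) + 2 * e + C ≤ δ * N := by
    intro C hC
    have h1 : e * (48 * (L + 1)) ≤ δ := (le_div_iff₀ (by positivity)).1 (min_le_right _ _)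
    have hNn : (0 : ℝ) ≤ N := by positivity
    nlinarith [mul_le_mul_of_nonneg_right h1 hNn, mul_le_mul_of_nonneg_left hN1 he0,
      mul_nonneg (mul_nonneg he0 hL.le) hNn, mul_nonneg he0 hNn]
  have hB := hbud C_T hCT
  have hB0 : 24 * e * (L * N) + 2 * e ≤ δ * N := by linarith [hbud 0 (by rw [mul_zero]; positivity)]
  -- the cell laws of the five families (abc-triples by `IsBalanced`)
  have cA := And.intro hFA0 (And.intro (fun T h => (hFA T h).1.1) (And.intro sA (And.intro fA (And.intro iA (And.intro lA tA)))))
  have cB := And.intro hFB0 (And.intro (fun T h => (hFB T h).1.1) (And.intro sB (And.intro fB (And.intro iB (And.intro lB tB)))))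
  have cC := And.intro hFC0 (And.intro (fun T h => (hFC T h).1.1) (And.intro sC (And.intro fC (And.intro iC (And.intro lC tC)))))
  have cG := And.intro hG0 (And.intro (fun T h => (hG T h).1.1) (And.intro sG (And.intro fG (And.intro iG (And.intro lG tG)))))
  have cG' := And.intro hG'0 (And.intro (fun T h => (hG' T h).1.1) (And.intro sG' (And.intro fG' (And.intro iG' (And.intro lG' tG')))))
  refine ⟨N, (le_max_left _ _).trans hN, FA, FB, FC, G, G', hFA0, hFB0, hFC0, hG0, hG'0, hFA, hFB, hFC, hG, hG',
    fun P Q V => ⟨(ce_bound he0 he2 cA P Q V).trans hB0, (ce_bound he0 he2 cB P Q V).trans hB0,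
      (ce_bound he0 he2 cC P Q V).trans hB0, (ce_bound he0 he2 cG P Q V).trans hB0,
      (ce_bound he0 he2 cG' P Q V).trans hB0⟩, fun Q V => ?_⟩
  exact ⟨(vm_bound he0 he2 cA cG' Pos.A Q V (hT _ _ _ _ _ _ Pos.A hα' hα hα hα' hα' hα' rfl Q V)).trans hB,
    (vm_bound he0 he2 cA cG Pos.B Q V (hT _ _ _ _ _ _ Pos.B hα' hα hα hα hα hα rfl Q V)).trans hB,
    (vm_bound he0 he2 cA cG Pos.C Q V (hT _ _ _ _ _ _ Pos.C hα' hα hα hα hα hα rfl Q V)).trans hB,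
    (vm_bound he0 he2 cB cG Pos.A Q V (hT _ _ _ _ _ _ Pos.A hα hα' hα hα hα hα rfl Q V)).trans hB,
    (vm_bound he0 he2 cB cG' Pos.B Q V (hT _ _ _ _ _ _ Pos.B hα hα' hα hα' hα' hα' rfl Q V)).trans hB,
    (vm_bound he0 he2 cB cG Pos.C Q V (hT _ _ _ _ _ _ Pos.C hα hα' hα hα hα hα rfl Q V)).trans hB,
    (vm_bound he0 he2 cC cG Pos.A Q V (hT _ _ _ _ _ _ Pos.A hα hα hα' hα hα hα rfl Q V)).trans hB,
    (vm_bound he0 he2 cC cG Pos.B Q V (hT _ _ _ _ _ _ Pos.B hα hα hα' hα hα hα rfl Q V)).trans hB,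
    (vm_bound he0 he2 cC cG' Pos.C Q V (hT _ _ _ _ _ _ Pos.C hα hα hα' hα' hα' hα' rfl Q V)).trans hB⟩

end Summit.ABC.ABC.Theorems.TameLocalReceptacle

end
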